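import Summits.KontsevichZagierPeriods.KontsevichZagierPeriods.Theorems.SymplecticScissorsTypeAGenerationStubRestrCOneAux
import Summits.KontsevichZagierPeriods.KontsevichZagierPeriods.Theorems.SymplecticScissorsTypeAGenerationStubRescalePiece
import Summits.KontsevichZagierPeriods.KontsevichZagierPeriods.Theses.SymplecticScissors
import Literature.NumberTheory.Transcendental.AyoubPeriodSeries
import Literature.NumberTheory.Transcendental.AyoubPeriodSeriesKernel
import Literature.NumberTheory.Transcendental.AyoubPeriodSeriesPiAlgebraic
import Literature.NumberTheory.Transcendental.AyoubPeriodSeriesVariables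
import Summits.KontsevichZagierPeriods.KontsevichZagierPeriods.Theorems.UnfoldedStokesStokesGenerationStubSpanToRepsAuxCoeff
import Mathlib.RingTheory.MvPowerSeries.Rename
import Mathlib.RingTheory.MvPowerSeries.Substitution
import Mathlib.Algebra.MvPolynomial.NoZeroDivisors

/-!
# `TypeAGeneration` (stmt-KontsevichZagierPeriods-18392), line `Sketch`, stub `stub_restrCOne` (S4):
the face map `G ↦ G|_{zᵢ=1}` preserves Ayoub's algebra `𝒪_{k-alg}(𝔻̄^∞)`

Registered stub `stub_restrCOne` of the crux `TypeAGeneration` (route SymplecticScissors, line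
`Sketch` = card stokes-compiler), on top of
`Literature/NumberTheory/Transcendental/AyoubPeriodSeries.lean` (`AyoubRel.Oan σ = 𝒪_{k-alg}(𝔻̄^∞)`:
power series in finitely many `zᵢ`, of polyradius `> 1`, algebraic over `k(z)`;
`AyoubRel.restrC i 1 = (·)|_{zᵢ=1}`) and of part 1
(`SymplecticScissorsTypeAGenerationStubRestrCOneAux.lean`: on the ring `ℓ¹` of absolutely summable
series the face map is additive and multiplicative; weights); `polyToCSeries σ` on `C r`, `X l` is
reused from the sibling stub file `SymplecticScissorsTypeAGenerationStubRescalePiece.lean`.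

For `G ∈ 𝒪_{k-alg}(𝔻̄^∞)` and `R = G|_{zᵢ=1}`, **algebraicity descends.** Let `ev : k[z] → k[z]`
be `zᵢ ↦ 1`. The face map restricts polynomials by `ev` (`s4_restrC_polyToCSeries`) and is a ring
homomorphism on `ℓ¹ ∋ G`, so a relation `P(G) = 0` gives `(P.map ev)(R) = 0` (`s4_restrC_eval₂`).
Choosing `P ≠ 0` with `P(G) = 0` and the total degree of its leading coefficient minimal,
`P.map ev ≠ 0` (`s4_descent`): otherwise every coefficient of `P` is divisible by `zᵢ - 1`
(`ev q = 0 ⟹ zᵢ - 1 ∣ q`, `s4_X_sub_one_dvd_sub_ev`), so `P = (zᵢ - 1) P'` with `P'(G) = 0`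
(`ℂ[[z]]` is a domain, `k[z] → ℂ[[z]]` is injective) and a leading coefficient of smaller total
degree. **Polyradius**: part 1's weighted estimate with the constant weight `r > 1`
(`s4_hasPolyradiusGtOne_restrC`); **variables**: `R` does not involve `zᵢ` and involves only
variables of `G` (a non-zero sum has a non-zero term).

Elementary (folklore); no definition is introduced (`ev` is written
`MvPolynomial.eval₂Hom C (Function.update X i 1)` throughout).
-/

noncomputable section

-- `Summit.KontsevichZagierPeriods.KontsevichZagierPeriods.…` is the tree's mandated layout (single-conjunct summit).
set_option linter.dupNamespace false

namespace Summit.KontsevichZagierPeriods.KontsevichZagierPeriods.TypeAGenerationLine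

open Finsupp MvPowerSeries
open Literature.NumberTheory.Transcendental
open Literature.NumberTheory.Transcendental.AyoubRel
open Summit.KontsevichZagierPeriods.KontsevichZagierPeriods.Theses.SymplecticScissors (TypeAGeneration)

/-! ## The evaluation `zᵢ ↦ 1` on `k[z]`; divisibility by `zᵢ - 1`; descent -/

section Descent

variable (k : Type) [Field k]

/-- `ev` (`zᵢ ↦ 1`) fixes constants. [folklore] -/
theorem s4_ev_C (i : ℕ) (r : k) :
    (MvPolynomial.eval₂Hom MvPolynomial.C (Function.update MvPolynomial.X i 1))
      (MvPolynomial.C r : MvPolynomial ℕ k) = MvPolynomial.C r :=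
  MvPolynomial.eval₂Hom_C _ _ r

/-- `ev zᵢ = 1`. [folklore] -/
theorem s4_ev_X_self (i : ℕ) :
    (MvPolynomial.eval₂Hom MvPolynomial.C (Function.update MvPolynomial.X i 1))
      (MvPolynomial.X i : MvPolynomial ℕ k) = 1 := by
  rw [MvPolynomial.eval₂Hom_X', Function.update_self]

/-- `ev z_l = z_l` for `l ≠ i`. [folklore] -/
theorem s4_ev_X_of_ne {i l : ℕ} (h : l ≠ i) :
    (MvPolynomial.eval₂Hom MvPolynomial.C (Function.update MvPolynomial.X i 1))
      (MvPolynomial.X l : MvPolynomial ℕ k) = MvPolynomial.X l := by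
  rw [MvPolynomial.eval₂Hom_X', Function.update_of_ne h]

/-- **`zᵢ - 1` divides `q - ev q`** (induction on `q`: `z_l - ev z_l ∈ {0, zᵢ - 1}`). [folklore] -/
theorem s4_X_sub_one_dvd_sub_ev (i : ℕ) (q : MvPolynomial ℕ k) :
    (MvPolynomial.X i - 1 : MvPolynomial ℕ k) ∣
      q - (MvPolynomial.eval₂Hom MvPolynomial.C (Function.update MvPolynomial.X i 1)) q := by
  induction q using MvPolynomial.induction_on with
  | C r =>
    rw [s4_ev_C, sub_self]
    exact dvd_zero _
  | add p q hp hq =>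
    rw [map_add, add_sub_add_comm]
    exact dvd_add hp hq
  | mul_X p l hp =>
    rw [map_mul, MvPolynomial.eval₂Hom_X']
    have e : p * MvPolynomial.X l -
        (MvPolynomial.eval₂Hom MvPolynomial.C (Function.update MvPolynomial.X i 1)) p *
          Function.update MvPolynomial.X i 1 l =
        (p - (MvPolynomial.eval₂Hom MvPolynomial.C (Function.update MvPolynomial.X i 1)) p) *
            MvPolynomial.X l +
          (MvPolynomial.eval₂Hom MvPolynomial.C (Function.update MvPolynomial.X i 1)) p *
            (MvPolynomial.X l - Function.update MvPolynomial.X i 1 l) := by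
      ring
    rw [e]
    refine dvd_add (hp.mul_right _) (Dvd.dvd.mul_left ?_ _)
    by_cases h : l = i
    · rw [h, Function.update_self]
    · rw [Function.update_of_ne h, sub_self]
      exact dvd_zero _

/-- The coefficient of `zᵢ` in `zᵢ - 1` is `1`. [folklore] -/
theorem s4_coeff_X_sub_one (i : ℕ) :
    MvPolynomial.coeff (single i 1) (MvPolynomial.X i - 1 : MvPolynomial ℕ k) = 1 := by
  rw [MvPolynomial.coeff_sub, MvPolynomial.coeff_X_same, MvPolynomial.coeff_one,
    if_neg (Finsupp.single_ne_zero.mpr one_ne_zero).symm, sub_zero]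

/-- `zᵢ - 1 ≠ 0` in `k[z]`. [folklore] -/
theorem s4_X_sub_one_ne_zero (i : ℕ) : (MvPolynomial.X i - 1 : MvPolynomial ℕ k) ≠ 0 := fun h => by
  have hc := s4_coeff_X_sub_one k i
  rw [h, MvPolynomial.coeff_zero] at hc
  exact zero_ne_one hc

/-- `zᵢ - 1` has positive total degree. [folklore] -/
theorem s4_totalDegree_X_sub_one_pos (i : ℕ) :
    0 < (MvPolynomial.X i - 1 : MvPolynomial ℕ k).totalDegree := by
  refine Nat.pos_of_ne_zero fun h0 => ?_
  have hc := s4_coeff_X_sub_one k i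
  rw [MvPolynomial.totalDegree_eq_zero_iff_eq_C] at h0
  rw [h0, MvPolynomial.coeff_C, if_neg (Finsupp.single_ne_zero.mpr one_ne_zero).symm] at hc
  exact zero_ne_one hc

variable {k} (σ : k →+* ℂ)

/-- **Descent of an algebraic relation through `zᵢ ↦ 1`.** If `G ∈ ℂ[[z]]` is algebraic over `k(z)`,
some relation `P(G) = 0` survives `ev`: `P.map ev ≠ 0`. Take `P ≠ 0` with `P(G) = 0` minimising the
total degree of the leading coefficient; if `P.map ev = 0` then `zᵢ - 1` divides every coefficient,
`P = C (zᵢ - 1) · P'`, `P'(G) = 0` (`ℂ[[z]]` is a domain, `k[z] → ℂ[[z]]` is injective) and the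
leading coefficient of `P'` has smaller total degree. [folklore] -/
theorem s4_descent {G : CSeries} (hG : IsAlgebraicOverRatFunc σ G) (i : ℕ) :
    ∃ P : Polynomial (MvPolynomial ℕ k),
      Polynomial.eval₂ (polyToCSeries σ) G P = 0 ∧
        P.map (MvPolynomial.eval₂Hom MvPolynomial.C (Function.update MvPolynomial.X i 1)) ≠ 0 := by
  classical
  have hex : ∃ n, ∃ P : Polynomial (MvPolynomial ℕ k), P ≠ 0 ∧
      Polynomial.eval₂ (polyToCSeries σ) G P = 0 ∧ P.leadingCoeff.totalDegree = n := by
    obtain ⟨P, hP, h0⟩ := hG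
    exact ⟨_, P, hP, h0, rfl⟩
  obtain ⟨P, hP0, hPG, hdeg⟩ := Nat.find_spec hex
  refine ⟨P, hPG, fun hmap => ?_⟩
  have hp0 := s4_X_sub_one_ne_zero k i
  -- every coefficient of `P` is divisible by `zᵢ - 1`
  have hdvd : ∀ m, (MvPolynomial.X i - 1 : MvPolynomial ℕ k) ∣ P.coeff m := fun m => by
    have h := s4_X_sub_one_dvd_sub_ev k i (P.coeff m)
    have h0 : (MvPolynomial.eval₂Hom MvPolynomial.C (Function.update MvPolynomial.X i 1))
        (P.coeff m) = 0 := by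
      rw [← Polynomial.coeff_map, hmap, Polynomial.coeff_zero]
    rwa [h0, sub_zero] at h
  obtain ⟨P', hP'⟩ := (Polynomial.C_dvd_iff_dvd_coeff _ P).mpr hdvd
  have hP'0 : P' ≠ 0 := by
    rintro rfl
    rw [mul_zero] at hP'
    exact hP0 hP'
  have hP'G : Polynomial.eval₂ (polyToCSeries σ) G P' = 0 := by
    have h := hPG
    rw [hP', Polynomial.eval₂_mul, Polynomial.eval₂_C, mul_eq_zero] at h
    exact h.resolve_left ((map_ne_zero_iff _ (polyToCSeries_injective σ)).mpr hp0)
  have hlt : P'.leadingCoeff.totalDegree < P.leadingCoeff.totalDegree := by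
    rw [hP', Polynomial.leadingCoeff_mul, Polynomial.leadingCoeff_C,
      MvPolynomial.totalDegree_mul_of_isDomain hp0 (Polynomial.leadingCoeff_ne_zero.mpr hP'0)]
    have h1 := s4_totalDegree_X_sub_one_pos k i
    omega
  rw [hdeg] at hlt
  exact Nat.find_min hex hlt ⟨P', hP'0, hP'G, rfl⟩

/-! ## The face map restricts polynomials by `ev`, and relations by `P ↦ P.map ev` -/

/-- Polynomials (pushed along `σ`) lie in `ℓ¹`. [folklore] -/
theorem s4_summable_norm_coeff_polyToCSeries (q : MvPolynomial ℕ k) :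
    Summable fun a : ℕ →₀ ℕ => ‖coeff a (polyToCSeries σ q)‖ := by
  change Summable fun a : ℕ →₀ ℕ => ‖coeff a ((MvPolynomial.map σ q : MvPolynomial ℕ ℂ) : CSeries)‖
  exact s4_summable_norm_coeff_coe _

/-- **The face map restricts polynomials by `zᵢ ↦ 1`**: `(q(z))|_{zᵢ=1} = (ev q)(z)` (induction on
`q`; additivity and the product rule on `ℓ¹`, `z_l|_{zᵢ=1} = ev z_l`). [folklore] -/
theorem s4_restrC_polyToCSeries (i : ℕ) (q : MvPolynomial ℕ k) :
    restrC i 1 (polyToCSeries σ q) = polyToCSeries σ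
      ((MvPolynomial.eval₂Hom MvPolynomial.C (Function.update MvPolynomial.X i 1)) q) := by
  induction q using MvPolynomial.induction_on with
  | C r => rw [s4_ev_C, s5_polyToCSeries_C, s4_restrC_C]
  | add p q hp hq =>
    rw [map_add, map_add, map_add, s4_restrC_add i (s4_summable_norm_coeff_polyToCSeries σ p)
      (s4_summable_norm_coeff_polyToCSeries σ q), hp, hq]
  | mul_X p l hp =>
    rw [map_mul, map_mul, map_mul, s4_restrC_mul (s4_summable_norm_coeff_polyToCSeries σ p)
      (s4_summable_norm_coeff_polyToCSeries σ _) i, hp, s5_polyToCSeries_X, s4_restrC_X]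
    by_cases h : l = i
    · rw [if_pos h, h, s4_ev_X_self, map_one]
    · rw [if_neg h, s4_ev_X_of_ne k h, s5_polyToCSeries_X]

/-- `P(G) ∈ ℓ¹` for `G ∈ ℓ¹` and `P ∈ k[z][Y]`. [folklore] -/
theorem s4_summable_norm_coeff_eval₂ {G : CSeries} (hG : Summable fun a : ℕ →₀ ℕ => ‖coeff a G‖)
    (P : Polynomial (MvPolynomial ℕ k)) :
    Summable fun a : ℕ →₀ ℕ => ‖coeff a (Polynomial.eval₂ (polyToCSeries σ) G P)‖ := by
  induction P using Polynomial.induction_on' with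
  | add p q hp hq =>
    rw [Polynomial.eval₂_add]
    exact s4_summable_norm_coeff_add hp hq
  | monomial n a =>
    rw [Polynomial.eval₂_monomial]
    exact s4_summable_norm_coeff_mul (s4_summable_norm_coeff_polyToCSeries σ a)
      (s4_summable_norm_coeff_pow hG n)

/-- **Relations restrict**: for `G ∈ ℓ¹`, `(P(G))|_{zᵢ=1} = (P.map ev)(G|_{zᵢ=1})` (the face map is
additive and multiplicative on `ℓ¹` and restricts the coefficients by `ev`). [folklore] -/
theorem s4_restrC_eval₂ {G : CSeries} (hG : Summable fun a : ℕ →₀ ℕ => ‖coeff a G‖) (i : ℕ)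
    (P : Polynomial (MvPolynomial ℕ k)) :
    restrC i 1 (Polynomial.eval₂ (polyToCSeries σ) G P) =
      Polynomial.eval₂ (polyToCSeries σ) (restrC i 1 G)
        (P.map (MvPolynomial.eval₂Hom MvPolynomial.C (Function.update MvPolynomial.X i 1))) := by
  induction P using Polynomial.induction_on' with
  | add p q hp hq =>
    rw [Polynomial.eval₂_add, Polynomial.map_add, Polynomial.eval₂_add,
      s4_restrC_add i (s4_summable_norm_coeff_eval₂ σ hG p) (s4_summable_norm_coeff_eval₂ σ hG q),
      hp, hq]
  | monomial n a =>
    rw [Polynomial.eval₂_monomial, Polynomial.map_monomial, Polynomial.eval₂_monomial,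
      s4_restrC_mul (s4_summable_norm_coeff_polyToCSeries σ a) (s4_summable_norm_coeff_pow hG n) i,
      s4_restrC_polyToCSeries, s4_restrC_pow hG]

/-- **`G|_{zᵢ=1}` is algebraic over `k(z)`** for `G ∈ 𝒪_{k-alg}(𝔻̄^∞)` (descent + restriction of the
surviving relation; `0|_{zᵢ=1} = 0`). [folklore] -/
theorem s4_isAlgebraicOverRatFunc_restrC {G : CSeries} (hG : G ∈ Oan σ) (i : ℕ) :
    IsAlgebraicOverRatFunc σ (restrC i 1 G) := by
  obtain ⟨P, hPG, hne⟩ := s4_descent σ hG.2.2 i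
  refine ⟨P.map (MvPolynomial.eval₂Hom MvPolynomial.C (Function.update MvPolynomial.X i 1)), hne,
    ?_⟩
  rw [← s4_restrC_eval₂ σ (summable_norm_coeff_of_mem_Oan σ hG) i P, hPG, restrC_zero]

end Descent

/-! ## Polyradius and variables -/

/-- **Polyradius `> 1` is preserved by the face map** (constant weight `r`). [folklore] -/
theorem s4_hasPolyradiusGtOne_restrC {G : CSeries} (hG : HasPolyradiusGtOne G) (i : ℕ) :
    HasPolyradiusGtOne (restrC i 1 G) := by
  obtain ⟨r, hr, hs⟩ := hG
  refine ⟨r, hr, ?_⟩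
  have hs' : Summable fun a : ℕ →₀ ℕ => ‖coeff a G‖ * a.prod fun l n => (fun _ : ℕ => r) l ^ n :=
    hs.congr fun a => by rw [s4_prod_const_pow r a]
  exact (s4_summable_weighted_restrC (fun _ => hr.le) hs' i).congr fun a => by
    rw [s4_prod_const_pow r a]

/-- `G|_{zᵢ=c}` does not involve `zᵢ`. [folklore] -/
theorem s4_not_usesVar_restrC (i : ℕ) (c : ℂ) (G : CSeries) : ¬ UsesVar (restrC i c G) i := by
  rintro ⟨a, ha, hne⟩
  rw [StokesGenerationLine.coeff_restrC, if_neg ha] at hne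
  exact hne rfl

/-- `G|_{zᵢ=1}` involves only variables of `G` (a non-zero sum has a non-zero term). [folklore] -/
theorem s4_usesVar_of_restrC {i l : ℕ} {G : CSeries} (h : UsesVar (restrC i 1 G) l) :
    UsesVar G l := by
  obtain ⟨a, hal, hne⟩ := h
  rw [s4_coeff_restrC_one] at hne
  split_ifs at hne with hai
  · by_contra hG
    apply hne
    have h0 : ∀ n : ℕ, coeff (a + single i n) G = 0 := fun n => by
      by_contra hn
      refine hG ⟨a + single i n, fun h0 => hal ?_, hn⟩
      rw [Finsupp.add_apply] at h0
      omega
    simp only [h0, tsum_zero]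
  · exact absurd rfl hne

/-! ## Registered form -/

/-- **S4 — the face map `G ↦ G|_{zᵢ=1}` preserves `𝒪_{k-alg}(𝔻̄^∞)`, weights and variables.**
For `G ∈ 𝒪_{k-alg}(𝔻̄^∞)`: `G|_{zᵢ=1} ∈ 𝒪_{k-alg}(𝔻̄^∞)` (restriction to the face is a ring
homomorphism on absolutely convergent series — Cauchy product and Fubini — so an algebraic relation
`P(z, G) = 0`, first divided by the exact power of `zᵢ − 1` dividing all its coefficients, restricts
to a non-trivial relation for `G|_{zᵢ=1}`); it does not involve `zᵢ` and involves only variables of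
`G`; and anisotropic weights `ρ ≥ 1` summable for `G` are summable for `G|_{zᵢ=1}`
(`Σ_b ‖Σₙ G_{b+neᵢ}‖ ρ^b ≤ Σ_a ‖G_a‖ ρ^a`). [folklore] -/
theorem stub_restrCOne :
    ∀ (k : Type) [Field k] [CharZero k] (σ : k →+* ℂ) (G : CSeries), G ∈ Oan σ → ∀ (i : ℕ),
      restrC i 1 G ∈ Oan σ ∧ ¬ UsesVar (restrC i 1 G) i ∧
      (∀ l : ℕ, UsesVar (restrC i 1 G) l → UsesVar G l) ∧
      (∀ ρ : ℕ → ℝ, (∀ l, 1 ≤ ρ l) →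
        Summable (fun a : ℕ →₀ ℕ => ‖MvPowerSeries.coeff a G‖ * a.prod fun l n => ρ l ^ n) →
        Summable (fun a : ℕ →₀ ℕ =>
          ‖MvPowerSeries.coeff a (restrC i 1 G)‖ * a.prod fun l n => ρ l ^ n)) := by
  intro k _ _ σ G hG i
  refine ⟨⟨?_, s4_hasPolyradiusGtOne_restrC hG.2.1 i, s4_isAlgebraicOverRatFunc_restrC σ hG i⟩,
    s4_not_usesVar_restrC i 1 G, fun l hl => s4_usesVar_of_restrC hl,
    fun ρ hρ hs => s4_summable_weighted_restrC hρ hs i⟩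
  obtain ⟨m, hm⟩ := hG.1
  exact ⟨m, StokesGenerationLine.dependsOnlyOnLT_restrC i 1 hm⟩

end Summit.KontsevichZagierPeriods.KontsevichZagierPeriods.TypeAGenerationLine
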